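import Mathlib

/-!
# `GrenetZeon.DualUnipotentThreeHalves` (stmt-ValiantsHypothesis-24318) — P-Q1 kernel port (lead-g2 `Q1-PROOF.md` §2 end, port map L2.6):
# THE EIGENVECTOR LEMMA, AND «COMMON KERNEL VECTOR ⇒ REDUCIBLE» IN THE ι-CURRENCY OF ✓ `heavyTopInst_five_seven_of_iota7`

Experiment cell «val-heavytop-census» (D-0160), engine seat val-htc-eng-1 (g3), kit 0; director R340 (3) (P-Q1 port, eng lineage).  Size-free (`Fin m`).

* `pow_mulVec_of_eigen`, ★ `mulVec_eq_zero_of_eigen_of_isNilpotent` — a nilpotent matrix with `Z e = c e`, `e ≠ 0`, has `Z e = 0`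
  (Q1-PROOF: «`Z e₁ = Z₁₁ e₁`; `Z` nilpotent forces `Z₁₁ = 0`»).
* `exists_eigen_of_mem_span`, ★ `mulVec_eq_zero_of_span_eigen` — if a space of nilpotent matrices is SPANNED by matrices having `e` as an eigenvector
  (the chart lifts `Â, Ê, ŵ_j, …` of Level 2 all map `e_0` into `ℂe_0`), every member kills `e` (port map L2.6 `eigenvector_lemma`);
  `mulVec_single_eq_smul_iff` — `Z e_{i₀} = c e_{i₀}` entrywise (column `i₀`).
* ★ `not_irreducible_of_common_kernel` — `m ≥ 2`, `e ≠ 0`, `V e = 0` ⇒ `¬ (∀ U, V-invariant → U = ⊥ ∨ U = ⊤)` (the line `ℂe`), i.e. `V` is NOT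
  irreducible in exactly the predicate of `hι7` in ✓ `heavyTopInst_five_seven_of_iota7` / eng-2 g3's ✓ `not_iota_le_choose`;
  `not_irreducible_of_common_kernel_conj` — the same for the conjugated space (`(P⁻¹ Z P) e = 0` for all `Z ∈ V`, with ✓ `…HeavyTopJordanShift`).
So the END of the Q1 port reads: Level 2 gives `(P⁻¹ Z P) e_0 = 0` on `V` (both exits, `V e_0 = 0` and `V = T₊ ⊂` strictly upper) ⇒ `V` reducible ⇒
no irreducible nilpotent subspace of `M_7` has dimension `20` ⇒ `hι7`.

Pure linear algebra; ι(7), (5,7), R2, 24318 OPEN / not moved; VP ≠ VNP NOT proved.  `--supports stmt-ValiantsHypothesis-24318 --as helper`.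
No definitions, no named facts. [lead-g2 `P-Q1-LEVEL2-PORTMAP.md` L2.6/L2.7; this seat]
-/

set_option linter.dupNamespace false
set_option autoImplicit false

namespace Summit.ValiantsHypothesis.ValiantsHypothesis.Theorems.GrenetZeon.HeavyTopCommonKernel

open Matrix
open scoped BigOperators

variable {m : ℕ}

/-! ## §1 The eigenvector lemma -/

/-- Powers act on an eigenvector by powers of the eigenvalue. [folklore] -/
theorem pow_mulVec_of_eigen (Z : Matrix (Fin m) (Fin m) ℂ) (e : Fin m → ℂ) (c : ℂ) (h : Z *ᵥ e = c • e) (k : ℕ) :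
    Z ^ k *ᵥ e = c ^ k • e := by
  induction k with
  | zero => rw [pow_zero, pow_zero, Matrix.one_mulVec, one_smul]
  | succ k ih => rw [pow_succ', ← Matrix.mulVec_mulVec, ih, Matrix.mulVec_smul, h, smul_smul, pow_succ, mul_comm]

/-- ★ **Eigenvector lemma**: a NILPOTENT matrix with an eigenvector `e ≠ 0`, `Z e = c e`, kills it (`c^n e = Z^n e = 0` forces `c = 0`).
Q1-PROOF §2: «`Z e₁ = Z₁₁ e₁` for all `Z ∈ V`; `Z` nilpotent forces `Z₁₁ = 0`». [folklore; this file] -/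
theorem mulVec_eq_zero_of_eigen_of_isNilpotent (Z : Matrix (Fin m) (Fin m) ℂ) (hZ : IsNilpotent Z) (e : Fin m → ℂ) (he : e ≠ 0)
    (c : ℂ) (h : Z *ᵥ e = c • e) : Z *ᵥ e = 0 := by
  obtain ⟨n, hn⟩ := hZ
  have h1 := pow_mulVec_of_eigen Z e c h n
  rw [hn, Matrix.zero_mulVec] at h1
  have hc : c ^ n = 0 := by
    rcases smul_eq_zero.1 h1.symm with h2 | h2
    · exact h2
    · exact absurd h2 he
  rw [h, pow_eq_zero_iff'.1 hc |>.1, zero_smul]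

/-- **Eigenvectors propagate along spans**: if every generator has `e` as an eigenvector, so does every member of the span. [folklore] -/
theorem exists_eigen_of_mem_span (S : Set (Matrix (Fin m) (Fin m) ℂ)) (e : Fin m → ℂ) (hS : ∀ M ∈ S, ∃ c : ℂ, M *ᵥ e = c • e)
    {Z : Matrix (Fin m) (Fin m) ℂ} (hZ : Z ∈ Submodule.span ℂ S) : ∃ c : ℂ, Z *ᵥ e = c • e := by
  refine Submodule.span_induction (p := fun Z _ => ∃ c : ℂ, Z *ᵥ e = c • e) hS ⟨0, by rw [Matrix.zero_mulVec, zero_smul]⟩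
    ?_ ?_ hZ
  · rintro x y - - ⟨c, hc⟩ ⟨d, hd⟩
    exact ⟨c + d, by rw [Matrix.add_mulVec, hc, hd, add_smul]⟩
  · rintro a x - ⟨c, hc⟩
    exact ⟨a * c, by rw [Matrix.smul_mulVec, hc, smul_smul]⟩

/-- ★ **Common kernel vector from eigen-generators**: if a linear space of NILPOTENT matrices is spanned by matrices having `e ≠ 0` as an
eigenvector, then every member kills `e`.  (Q1-PROOF §2, conclusion: the basis lifts `Â, Ê, ŵ_j, …` all map `e_0` into `ℂ e_0`, hence
`V e_0 = 0`.) [this file] -/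
theorem mulVec_eq_zero_of_span_eigen (S : Set (Matrix (Fin m) (Fin m) ℂ)) (V : Submodule ℂ (Matrix (Fin m) (Fin m) ℂ))
    (hV : V = Submodule.span ℂ S) (hnil : ∀ Z ∈ V, IsNilpotent Z) (e : Fin m → ℂ) (he : e ≠ 0)
    (hS : ∀ M ∈ S, ∃ c : ℂ, M *ᵥ e = c • e) : ∀ Z ∈ V, Z *ᵥ e = 0 := by
  intro Z hZ
  obtain ⟨c, hc⟩ := exists_eigen_of_mem_span S e hS (by rw [← hV]; exact hZ)
  exact mulVec_eq_zero_of_eigen_of_isNilpotent Z (hnil Z hZ) e he c hc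

/-- `Z e_0 = c e_0` is the statement «column `0` of `Z` is `c e_0`»: a convenient entrywise form for the chart lifts. [this file] -/
theorem mulVec_single_eq_smul_iff (Z : Matrix (Fin m) (Fin m) ℂ) (i₀ : Fin m) (c : ℂ) :
    Z *ᵥ Pi.single i₀ 1 = c • Pi.single i₀ 1 ↔ ∀ i, Z i i₀ = if i = i₀ then c else 0 := by
  have key : ∀ i, (Z *ᵥ Pi.single i₀ 1) i = Z i i₀ := fun i => by
    simp [Matrix.mulVec, dotProduct, Pi.single_apply]
  have key2 : ∀ i, (c • (Pi.single i₀ 1 : Fin m → ℂ)) i = if i = i₀ then c else 0 := fun i => by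
    simp [Pi.single_apply]
  constructor
  · intro h i
    rw [← key i, h, key2 i]
  · intro h
    ext i
    rw [key i, key2 i, h i]

/-! ## §2 Common kernel vector ⇒ reducible (the ι-currency predicate of ✓ `heavyTopInst_five_seven_of_iota7`) -/

/-- ★ **A common kernel vector is a non-trivial invariant line**: if `m ≥ 2`, `e ≠ 0` and `Z e = 0` for every `Z ∈ V`, then `V` is REDUCIBLE in
the sense of the ι-currency — NOT every invariant subspace is `⊥` or `⊤` (the line `ℂe` is invariant).  This is how Q1-PROOF's conclusion
«`V e₁ = 0` (or `V = T₊`, which also kills `e₁`)» feeds `hι7` of ✓ `heavyTopInst_five_seven_of_iota7`. [this file] -/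
theorem not_irreducible_of_common_kernel (hm : 2 ≤ m) (V : Submodule ℂ (Matrix (Fin m) (Fin m) ℂ)) (e : Fin m → ℂ) (he : e ≠ 0)
    (hV : ∀ Z ∈ V, Z *ᵥ e = 0) :
    ¬ ∀ U : Submodule ℂ (Fin m → ℂ), (∀ A ∈ V, ∀ x ∈ U, A *ᵥ x ∈ U) → U = ⊥ ∨ U = ⊤ := by
  intro h
  have hinv : ∀ A ∈ V, ∀ x ∈ Submodule.span ℂ ({e} : Set (Fin m → ℂ)), A *ᵥ x ∈ Submodule.span ℂ ({e} : Set (Fin m → ℂ)) := by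
    intro A hA x hx
    obtain ⟨a, rfl⟩ := Submodule.mem_span_singleton.1 hx
    rw [Matrix.mulVec_smul, hV A hA, smul_zero]
    exact Submodule.zero_mem _
  rcases h _ hinv with h0 | h1
  · rw [Submodule.span_singleton_eq_bot] at h0
    exact he h0
  · have h2 := finrank_span_singleton (K := ℂ) he
    rw [h1, finrank_top, Module.finrank_fintype_fun_eq_card, Fintype.card_fin] at h2
    omega

/-- **Conjugation-ready form**: the same with the common kernel vector `P e` of the conjugated space — if `Z (P e) = 0` for all `Z ∈ V` (e.g.
`P⁻¹ Z P` kills `e`), `V` is reducible. [this file] -/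
theorem not_irreducible_of_common_kernel_conj (hm : 2 ≤ m) (V : Submodule ℂ (Matrix (Fin m) (Fin m) ℂ))
    (P : Matrix (Fin m) (Fin m) ℂ) (hP : IsUnit P) (e : Fin m → ℂ) (he : e ≠ 0)
    (hV : ∀ Z ∈ V, (P⁻¹ * Z * P) *ᵥ e = 0) :
    ¬ ∀ U : Submodule ℂ (Fin m → ℂ), (∀ A ∈ V, ∀ x ∈ U, A *ᵥ x ∈ U) → U = ⊥ ∨ U = ⊤ := by
  have hPdet : IsUnit P.det := (Matrix.isUnit_iff_isUnit_det P).1 hP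
  refine not_irreducible_of_common_kernel hm V (P *ᵥ e) ?_ ?_
  · intro h0
    apply he
    have := congrArg (fun x => P⁻¹ *ᵥ x) h0
    simpa [Matrix.mulVec_mulVec, Matrix.nonsing_inv_mul P hPdet] using this
  · intro Z hZ
    have h1 := congrArg (fun x => P *ᵥ x) (hV Z hZ)
    simp only [Matrix.mulVec_zero, Matrix.mulVec_mulVec] at h1
    rwa [← Matrix.mul_assoc, ← Matrix.mul_assoc, Matrix.mul_nonsing_inv P hPdet, Matrix.one_mul, ← Matrix.mulVec_mulVec] at h1

end Summit.ValiantsHypothesis.ValiantsHypothesis.Theorems.GrenetZeon.HeavyTopCommonKernel
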